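import Literature.MathematicalPhysics.QuantumFieldTheory.Balaban1983to89.B10StarLower

/-!
# Bałaban CMP 102 (1985), d = 3 lane — `Proofs.Constants`: the ONE k- and ε-independent constant profile of the construction
# (lane ruling R-CONST) and its map to the 4D cell's `B10Assembly.Consts` in normalised units (R-NORM)

Source: T. Bałaban, *Ultraviolet stability of three-dimensional lattice pure gauge field theories*, Commun. Math. Phys. **102**
(1985) 255–275 [Balaban1985UV3] ([B10]; PDF page = journal page − 254).  Lane `pub-balaban3d`, seat p3; rulings R-CONST / R-NORM
(HOME/STATUS.md 2026-08-21T23:54:58Z [lead-g2], PLAN v1.3 §3.0; LEAF-LEDGER.md §B, C15).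

WHAT PRINT SAYS ABOUT THE CONSTANTS.  p. 257 L1–2: «and the constant O(1) is independent of ε, k, g_k in a bounded set»; p. 256
L24: «with a constant O(1) depending on g and ε₀ only»; (7) p. 257: «p(g) = b₀(1 + log g^{−1})^{p₀}, p₀ > 2 and b₀ is a
sufficiently large absolute constant»; p. 262 L3 / p. 269 L24: the remainder exponent «κ₀ > 0»; p. 262 L40: «κ can be arbitrarily
large if M₁ is sufficiently large»; (18) p. 260: «σ₀ = σ(0)»; (22) p. 261: «d(𝔤) denotes a dimension of the Lie algebra 𝔤».  Every
other O(1) of Sects. A–D ((24)/(58), (33)/(60), pp. 264–265, (35)/(61), the star-count deficit, p. 272, (46), (65), pp. 273–274)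
is an unnamed absolute constant in print.

WHAT THIS FILE DOES (definitions of RECORDS OF NAMES + elementary lemmas; nothing of the paper is asserted):
* `StepConsts` — nine of the ten O(1)'s of one renormalization step as the 4D cell's `StepLeaves` names them (`Cz, C₁, C₁', C₂, Cv,
  C₃, C₄, C₅, C₆`, `B10SectAGathering.StepLeaves` ll. 586–595; the tenth, the star-count deficit `c₁`, is `3` in d = 3, §3), ONE
  profile for every step k and every lattice approximation (R-CONST); with the sign conditions that make the remainder coefficient
  `rstar = max C₁ C₁' + C₂ + C₃ + C₄` honest (`≥ 0`).
* `FamilyConsts L` — the remaining family parameters and O(1)'s: `κ₀, M₁, b₀, p₀` (print), `C46` ((46)), `z`, `aP` ((65) inputs),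
  the group constants `logσ₀` ((18)) and `dimg = d(𝔤)` ((22)).
* `consts3` — THE LANE'S `B10Assembly.Consts` INSTANCE in normalised units: `g := 1` (R-NORM: the 4D cell's `LeafSystem.ε` is
  instantiated with g₀² = g²ε, so one record serves every bare coupling), `L := L`, `rstar := max C₁ C₁' + C₂ + C₃ + C₄`
  (`B10SectAGathering.StepLeaves.rmSucc`), `σmax := |log σ₀|`, `dg := d(𝔤)`, `d := 6 / log L` (seat p2's `lf_leaf_of_leaves`,
  `LargeFieldKnit`), the rest copied; `NormalisedConsts` records `C.g = 1 ∧ C.L = L` for the end-assembly file, and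
  `normalisedConsts_consts3`, `consts3_d`, `consts3_rstar`, … are the `rfl`-level projections the leaf seats instantiate against.
* `c₁ = 3`: the star-count deficit constant of the UNPRINTED count behind p. 265 L8–9 / p. 271 L13 (leaf
  `B10SectAGathering.StarCount`, LEAF-LEDGER C9) is `3`, uniformly in the block size, for step pieces recording the concrete d = 3
  counts (`starCount_leaf_three`, from `B10StarCount.starCount_deficit_d3`).
HONEST FRAMING (PLAN §0): names and arithmetic only; the VALUES of `C46, z, aP, Cz, C₁, …` are supplied by the seats proving the
corresponding leaves (R-CONST), as closed real expressions; nothing here is a claim about Yang–Mills.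
-/

namespace Summit.QuantumFields.Balaban3D.Proofs.Constants

open Literature.MathematicalPhysics.QuantumFieldTheory.Balaban1983to89
open Literature.MathematicalPhysics.QuantumFieldTheory.Balaban1983to89.B10

/-! ## §1 The records of names -/

/-- THE STEP CONSTANTS (R-CONST), one profile for all steps and all lattice approximations: the O(1)'s of the fourteen step
leaves exactly as `B10SectAGathering.StepLeaves` names them — `Cz`, `C₁` ((24)/(58)–(59) p. 262/p. 270: cumulant remainder and its
`O(g_k)|Z_k|` part), `C₁'` (lower cumulant direction, (37)/(47)), `C₂` ((33)/(60) representation remainder), `Cv`, `C₃` (whole-lattice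
vacuum sum, pp. 264–265 / p. 270), `C₄` ((35)/(61) log-Z decomposition), `C₅` ((35) normalisation), `C₆` (p. 272 old terms outside
Ω_{k+1}); the star-count deficit constant `c₁` of `StepLeaves` is not a parameter: it is `3` (§3, `starCount_leaf_three`).  The four
remainder constants are taken `≥ 0` (honest O(1)'s), so that the remainder coefficient `rstar` of (41) is `≥ 0` as
`B10Assembly.Consts` demands.  Names only. [cite: Balaban1985UV3, (24)–(35) pp.262–265 + (58)–(61) pp.270–271] -/
structure StepConsts where
  /-- the `O(g_k)|Z_k|` coefficient of (58)–(59) p. 270 -/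
  Cz : ℝ
  /-- the remainder O(1) of the cumulant expansion (24) p. 262 / (58) p. 270 -/
  C₁ : ℝ
  /-- the remainder O(1) of the lower cumulant direction (37) p. 265 / (47) -/
  C₁' : ℝ
  /-- the remainder O(1) of the representation (33) p. 264 / (60) p. 271 -/
  C₂ : ℝ
  /-- the `O(g_k)|Z_k|` coefficient of the whole-lattice vacuum sum (p. 265 / p. 270) -/
  Cv : ℝ
  /-- the remainder O(1) of the whole-lattice vacuum sum -/
  C₃ : ℝ
  /-- the remainder O(1) of the log-Z decomposition (35) p. 265 / (61) p. 271 -/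
  C₄ : ℝ
  /-- the O(1) of the normalisation (35) p. 265: |log Z(Ω₁,1) − log Z(T₁,1)| ≤ O(1)|Ω₁ᶜ| -/
  C₅ : ℝ
  /-- the O(1) of p. 272: old terms with Y_j ⊄ Ω_{k+1} bounded by O(1)|Z_k| -/
  C₆ : ℝ
  C₁_nonneg : 0 ≤ C₁
  C₂_nonneg : 0 ≤ C₂
  C₃_nonneg : 0 ≤ C₃
  C₄_nonneg : 0 ≤ C₄

namespace StepConsts

/-- The remainder coefficient of (41)/(47) gathered from one step: `rstar = max C₁ C₁' + C₂ + C₃ + C₄`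
(`B10SectAGathering.StepLeaves.rmSucc`). [cite: Balaban1985UV3, (36) p.265 + (41) p.266] -/
def rstar (sc : StepConsts) : ℝ := max sc.C₁ sc.C₁' + sc.C₂ + sc.C₃ + sc.C₄

/-- `rstar ≥ 0`. [folklore] -/
theorem rstar_nonneg (sc : StepConsts) : 0 ≤ sc.rstar := by
  unfold rstar
  have h1 : 0 ≤ max sc.C₁ sc.C₁' := le_trans sc.C₁_nonneg (le_max_left _ _)
  linarith [sc.C₂_nonneg, sc.C₃_nonneg, sc.C₄_nonneg]

end StepConsts

/-- THE FAMILY PARAMETERS AND THE REMAINING O(1)'s: `κ₀ > 0` (p. 262 L3 «κ₀ > 0»), `M₁ ≥ 1` (big-block size in sites, p. 257), `b₀ > 0`,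
`p₀ > 2` ((7) p. 257 «p₀ > 2 and b₀ is a sufficiently large absolute constant», AS PRINTED), `r₀`, `R₁` ((7) «R = R₁(1 + log g₀⁻¹)^{r₀}»), `C46 ≥ 0` ((46) p. 267), `z ≥ 0`, `aP ≥ 0` (the two O(1)'s of (65) p. 273 «we get easily |E^{(j)}| ≤ O(1)|T₁^{(j)}|»),
and the GROUP constants `logσ₀ = log σ(0)` ((18) p. 260) and `dimg = d(𝔤)` ((22) p. 261) of the one compact group of the family
(values from the carrier seat's group model: σ₀ = the Haar density at the origin of the exponential chart, d(𝔤) = `finrank ℝ 𝔤`).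
Names only. [cite: Balaban1985UV3, (7) p.257 + (18) p.260 + (22) p.261 + (46) p.267 + (65) p.273] -/
structure FamilyConsts (L : ℕ) where
  /-- the remainder exponent κ₀ of p. 262 / p. 269 -/
  κ₀ : ℝ
  /-- the big-block size M₁ (p. 257 «blocks of the size M₁»; a positive number of sites) -/
  M₁ : ℕ
  /-- p(g) = b₀(1 + log g⁻¹)^{p₀}, (7) p. 257 «b₀ is a sufficiently large absolute constant» -/
  b₀ : ℝ
  /-- p(g) = b₀(1 + log g⁻¹)^{p₀}, (7) p. 257 «p₀ > 2» -/
  p₀ : ℝ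
  /-- «We take R = R₁(1 + log g₀⁻¹)^{r₀} = R₁r(g₀)» (7) p. 257 L38–39 / (39) p. 266 «R(g_j) = R₁r(g_j)»: the exponent r₀ (free in
  print; LQB `B10.rFun r₀`) -/
  r₀ : ℝ
  /-- the collar constant R₁ of (7) p. 257 / (39) p. 266 (its needed size is not printed; cell SMALLNESS S-B10.9: R₁ ≥ 6 + 2κ₀
  where `B10Assembly.largeLoc_le_rpow` is used) -/
  R₁ : ℝ
  /-- the O(1) of (46) p. 267 -/
  C46 : ℝ
  /-- the O(1) of |log Z^{(k)}(T₁^{(k)}, 1)| ≤ O(1)|T₁^{(k)}| (p. 273) -/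
  z : ℝ
  /-- the O(1) of |Σ_X 𝒫′_{k+1}(g_k, X, 1)| ≤ O(1)|T₁^{(k)}| (p. 273, from (25)) -/
  aP : ℝ
  /-- log σ₀, σ₀ = σ(0) of (18) p. 260 -/
  logσ₀ : ℝ
  /-- d(𝔤), (22) p. 261 -/
  dimg : ℕ
  one_lt_L : 1 < L
  κ₀_pos : 0 < κ₀
  /-- `M₁ ≥ 1` (a block has at least one site; p. 262 L40 «if M₁ is sufficiently large») -/
  M₁_pos : 0 < M₁
  /-- «b₀ is a sufficiently large absolute constant» (7) p. 257: in particular positive (so p(g) > 0) -/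
  b₀_pos : 0 < b₀
  /-- «p₀ > 2» (7) p. 257, AS PRINTED -/
  two_lt_p₀ : 2 < p₀
  C46_nonneg : 0 ≤ C46
  z_nonneg : 0 ≤ z
  aP_nonneg : 0 ≤ aP

namespace FamilyConsts

/-- `p₀ > 0` (from the printed `p₀ > 2`). [folklore] -/
theorem p₀_pos {L : ℕ} (F : FamilyConsts L) : 0 < F.p₀ := lt_trans two_pos F.two_lt_p₀

/-- `b₀ ≥ 0`. [folklore] -/
theorem b₀_nonneg {L : ℕ} (F : FamilyConsts L) : 0 ≤ F.b₀ := F.b₀_pos.le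

end FamilyConsts

/-! ## §2 The lane's `B10Assembly.Consts` in normalised units -/

/-- NORMALISED FAMILY CONSTANTS (R-NORM): a `B10Assembly.Consts` record with bare coupling `1` and block size `L`, so that the 4D cell's
model scaling `g_k = gRun C.g C.L ε k`, `|T₁^{(k)}| = sitesRun C.L ε Tε k` is met by every lattice approximation with `ε ↦ g₀² = g²ε`
((1) p. 256 L4), `Tε ↦ g⁶|T_ε|`. [cite: Balaban1985UV3, (1) + (5) p.256] -/
def NormalisedConsts (L : ℕ) (C : B10Assembly.Consts) : Prop :=
  C.g = 1 ∧ C.L = (L : ℝ)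

/-- **THE LANE'S CONSTANTS RECORD** (R-CONST): `g := 1`, `L := L`, `rstar := max C₁ C₁' + C₂ + C₃ + C₄`, `σmax := |log σ₀|`,
`dg := d(𝔤)`, `d := 6 / log L` (seat p2's large-field constant), the rest copied from the two profiles. [cite: Balaban1985UV3, p.256 + p.257 + p.273] -/
noncomputable def consts3 {L : ℕ} (F : FamilyConsts L) (sc : StepConsts) : B10Assembly.Consts where
  g := 1
  L := L
  κ₀ := F.κ₀
  M₁ := (F.M₁ : ℝ)
  b₀ := F.b₀
  p₀ := F.p₀
  C46 := F.C46
  σmax := |F.logσ₀|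
  dg := F.dimg
  z := F.z
  aP := F.aP
  rstar := sc.rstar
  d := 6 / Real.log L
  g_pos := one_pos
  one_lt_L := by exact_mod_cast F.one_lt_L
  κ₀_pos := F.κ₀_pos
  M₁_nonneg := Nat.cast_nonneg _
  p₀_pos := F.p₀_pos
  C46_nonneg := F.C46_nonneg
  σmax_nonneg := abs_nonneg _
  dg_nonneg := Nat.cast_nonneg _
  z_nonneg := F.z_nonneg
  aP_nonneg := F.aP_nonneg
  rstar_nonneg := sc.rstar_nonneg
  d_nonneg := by
    have h : (1 : ℝ) < L := by exact_mod_cast F.one_lt_L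
    exact div_nonneg (by norm_num) (Real.log_pos h).le

variable {L : ℕ} (F : FamilyConsts L) (sc : StepConsts)

/-- `consts3` is normalised: `g = 1`, `L = L`. [folklore] -/
theorem normalisedConsts_consts3 : NormalisedConsts L (consts3 F sc) := ⟨rfl, rfl⟩

/-- (projection) the large-field constant is `6 / log L`. [folklore] -/
theorem consts3_d : (consts3 F sc).d = 6 / Real.log L := rfl

/-- (projection) `C.d = 6 / log C.L` — the hypothesis `hd` of seat p2's `lf_leaf_of_leaves`. [folklore] -/
theorem consts3_d_eq_log : (consts3 F sc).d = 6 / Real.log (consts3 F sc).L := rfl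

/-- (projection) the remainder coefficient is the gathered `max C₁ C₁' + C₂ + C₃ + C₄`. [folklore] -/
theorem consts3_rstar : (consts3 F sc).rstar = max sc.C₁ sc.C₁' + sc.C₂ + sc.C₃ + sc.C₄ := rfl

/-- (projection) `σmax = |log σ₀|`, so `LeafSystem.logσ₀_le` is `le_refl` for pieces with `logσ₀ := F.logσ₀`. [folklore] -/
theorem consts3_σmax : (consts3 F sc).σmax = |F.logσ₀| := rfl

/-- (projection) `dg = d(𝔤)`, so `LeafSystem.dg_le` is `le_refl` for pieces with `dg := F.dimg`. [folklore] -/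
theorem consts3_dg : (consts3 F sc).dg = (F.dimg : ℝ) := rfl

/-- (projections) the copied parameters. [folklore] -/
theorem consts3_par : (consts3 F sc).κ₀ = F.κ₀ ∧ (consts3 F sc).M₁ = (F.M₁ : ℝ) ∧ (consts3 F sc).b₀ = F.b₀ ∧ (consts3 F sc).p₀ = F.p₀ ∧
    (consts3 F sc).C46 = F.C46 ∧ (consts3 F sc).z = F.z ∧ (consts3 F sc).aP = F.aP :=
  ⟨rfl, rfl, rfl, rfl, rfl, rfl, rfl⟩

/-! ## §3 The star-count deficit constant `c₁ = 3` (LEAF-LEDGER C9) -/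

/-- `StarCount` is monotone in its constant (|Z_k| ≥ 0). [folklore] -/
theorem starCount_mono {T : TowerRun} {k : ℕ} (P : B10SectAGathering.StepPieces T k) {c c' : ℝ}
    (h : B10SectAGathering.StarCount P c) (hle : c ≤ c') : B10SectAGathering.StarCount P c' := by
  intro hst
  obtain ⟨h0, h1⟩ := h hst
  exact ⟨h0, h1.trans (mul_le_mul_of_nonneg_right hle (P.Zvol_nonneg hst))⟩

/-- **THE STAR-COUNT LEAF WITH `c₁ = 3`, uniformly in the block size** (LEAF-LEDGER C9; the unprinted count behind p. 265 L8–9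
«We have to supplement also the constants in (22), involving log σ₀ and log g₀, to the whole lattice» and p. 271 L13 «Complementing
the constants in (55) to the full lattice T^{(k)}»): for step pieces over ANY tower whose `starT`, `starB h`, `Zvol h` are the d = 3
counts of `B10StarCount` for some assignment of coarse regions `Λ_{k+1}(h)`, `0 ≤ |T₁^{(k)*}| − |B(Λ_{k+1})*| ≤ 3|Z_k|` — i.e.
`B10SectAGathering.StarCount P 3` (`B10StarCount.starCount_leaf` gives `c⋆/L³`, and `c⋆/L³ < 3` by `cStar_div_lt_three`). [cite: Balaban1985UV3, p.265 + p.271] -/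
theorem starCount_leaf_three {P : Params} {j : ℕ} (hd : P.d = 3) (hj : j + 1 ≤ P.m + P.K) {T : TowerRun} {k : ℕ}
    (S : B10SectAGathering.StepPieces T k) (Λ : T.Hist (k + 1) → Finset (Site P (j + 1)))
    (hT : S.starT = (B10StarCount.starCount (Finset.univ : Finset (Site P (j + 1))) : ℝ))
    (hB : ∀ h, S.starB h = (B10StarCount.starCount (Λ h) : ℝ))
    (hZ : ∀ h, S.Zvol h = (((B10StarCount.blockSet (Λ h))ᶜ).card : ℝ)) :
    B10SectAGathering.StarCount S 3 :=
  starCount_mono S (B10StarCount.starCount_leaf S hj Λ hT hB hZ) (B10StarCount.cStar_div_lt_three (P := P) hd).le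

/-- The same with the complement volume only BOUNDED BELOW by the site count of `B(Λ_{k+1})ᶜ` (robust to the carrier seat's
definition of `|Z_k|`, e.g. with big-block rounding: any `Zvol h ≥ #(T^{(k)} ∖ B(Λ_{k+1}(h)))` works). [cite: Balaban1985UV3, p.265 + p.271] -/
theorem starCount_leaf_three_of_le {P : Params} {j : ℕ} (hd : P.d = 3) (hj : j + 1 ≤ P.m + P.K) {T : TowerRun} {k : ℕ}
    (S : B10SectAGathering.StepPieces T k) (Λ : T.Hist (k + 1) → Finset (Site P (j + 1)))
    (hT : S.starT = (B10StarCount.starCount (Finset.univ : Finset (Site P (j + 1))) : ℝ))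
    (hB : ∀ h, S.starB h = (B10StarCount.starCount (Λ h) : ℝ))
    (hZ : ∀ h, (((B10StarCount.blockSet (Λ h))ᶜ).card : ℝ) ≤ S.Zvol h) :
    B10SectAGathering.StarCount S 3 := by
  intro h
  obtain ⟨h0, h1⟩ := B10StarCount.starCount_deficit_d3 hd hj (Λ h)
  rw [hT, hB h]
  exact ⟨h0, h1.trans (mul_le_mul_of_nonneg_left (hZ h) (by norm_num))⟩

/-! ## §4 The terminal spacing ε₀ = ε₀(g) EXHIBITED (ruling R-EPS0′): `ε₀(g) = (min γ₀ 1)²/g²` -/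

/-- **ε₀ AS A FUNCTION OF g** (p. 256 L15–18 «when L^kε = ε₀, where ε₀ is a positive constant depending on the coupling
constant g only»; ruling R-EPS0′: the spine types «∃ eps0 : ℝ → ℝ», the end theorem EXHIBITS it): with `γ₀` the minimum of
the leaf seats' explicit smallness thresholds ((12) p. 258 L34 «2L²g₀p(g₀) ≤ a₁», (45) p. 267 L9, (71) p. 273 L27 «for g_j
sufficiently small»), `ε₀(g) := (min γ₀ 1)²/g²` — so that the terminal (largest) coupling is `g_K = gε₀^{1/2} = min γ₀ 1` and
`g_k ≤ γ₀`, `g_k ≤ 1` for every `k ≤ K` (`ScalesArithmetic.gK_eq_of_eps0Of`, `gk_le_gamma0_of_eps0Of`). [cite: Balaban1985UV3, (2) p.256] -/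
noncomputable def eps0Of (γ₀ g : ℝ) : ℝ := (min γ₀ 1) ^ 2 / g ^ 2

/-- `ε₀(g) > 0` for `γ₀ > 0`, `g > 0` (the positivity conjunct of the spine's `∃ eps0`). [folklore] -/
theorem eps0Of_pos {γ₀ g : ℝ} (hγ : 0 < γ₀) (hg : 0 < g) : 0 < eps0Of γ₀ g := by
  unfold eps0Of
  have : 0 < min γ₀ 1 := lt_min hγ one_pos
  positivity

/-- `g²·ε₀(g) = (min γ₀ 1)²` (g > 0). [folklore] -/
theorem gsq_mul_eps0Of {γ₀ g : ℝ} (hg : 0 < g) : g ^ 2 * eps0Of γ₀ g = (min γ₀ 1) ^ 2 := by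
  unfold eps0Of
  field_simp

/-- `g²·ε₀(g) ≤ 1` for `γ₀ ≥ 0` — the spine's normalisation field `Scales.gK_le_one` holds on the exhibited family. [folklore] -/
theorem gsq_mul_eps0Of_le_one {γ₀ g : ℝ} (hγ : 0 ≤ γ₀) (hg : 0 < g) : g ^ 2 * eps0Of γ₀ g ≤ 1 := by
  rw [gsq_mul_eps0Of hg]
  have h0 : 0 ≤ min γ₀ 1 := le_min hγ zero_le_one
  have h1 : min γ₀ 1 ≤ 1 := min_le_right _ _
  nlinarith

/-- `g·ε₀(g)^{1/2} = min γ₀ 1` for `γ₀ ≥ 0`, `g > 0`: the terminal coupling on the exhibited family. [folklore] -/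
theorem mul_sqrt_eps0Of {γ₀ g : ℝ} (hγ : 0 ≤ γ₀) (hg : 0 < g) : g * Real.sqrt (eps0Of γ₀ g) = min γ₀ 1 := by
  have h0 : 0 ≤ min γ₀ 1 := le_min hγ zero_le_one
  unfold eps0Of
  rw [show (min γ₀ 1) ^ 2 / g ^ 2 = (min γ₀ 1 / g) ^ 2 by rw [div_pow], Real.sqrt_sq (div_nonneg h0 hg.le)]
  field_simp

/-! ## §5 The lane's smallness threshold `γ₀` = the minimum of the leaf seats' thresholds (R-EPS0′, R-CONST) -/

/-- `γ₀ := min(1, γ_1, …, γ_n)` for a LIST of seat thresholds (p2: `gamma46`, `gamma71` of `Thresholds.lean` — (45) p. 267 L9, (71)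
p. 273 L27 «for g_j sufficiently small»; p4: `γ_12`, `γ_16` — (12) p. 258 L34 «2L²g₀p(g₀) ≤ a₁», p. 259 L12; p5/p6: any further
one); each seat's premise `g_k ≤ γ_X` then follows from `ScalesArithmetic.gk_le_gamma0_of_eps0Of` and `gammaMin_le`. [cite: Balaban1985UV3, p.256 L15–18 + p.267 L9 + p.273 L27] -/
def gammaMin (l : List ℝ) : ℝ := l.foldr min 1

/-- `γ₀ ≤ 1`. [folklore] -/
theorem gammaMin_le_one (l : List ℝ) : gammaMin l ≤ 1 := by
  induction l with
  | nil => exact le_rfl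
  | cons a l ih => exact (min_le_right _ _).trans ih

/-- `γ₀ ≤ γ_X` for every listed threshold. [folklore] -/
theorem gammaMin_le {l : List ℝ} {x : ℝ} (hx : x ∈ l) : gammaMin l ≤ x := by
  induction l with
  | nil => simp at hx
  | cons a l ih =>
    rcases List.mem_cons.mp hx with h | h
    · subst h; exact min_le_left _ _
    · exact (min_le_right _ _).trans (ih h)

/-- `γ₀ > 0` when every listed threshold is positive. [folklore] -/
theorem gammaMin_pos {l : List ℝ} (h : ∀ x ∈ l, 0 < x) : 0 < gammaMin l := by
  induction l with
  | nil => exact one_pos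
  | cons a l ih =>
    exact lt_min (h a (by simp)) (ih fun x hx => h x (List.mem_cons_of_mem _ hx))

end Summit.QuantumFields.Balaban3D.Proofs.Constants
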